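import Summits.ValiantsHypothesis.ValiantsHypothesis.Theses.FifoMatching
import Summits.ValiantsHypothesis.ValiantsHypothesis.Theorems.FifoMatchingAv231Circuit
import Summits.ValiantsHypothesis.ValiantsHypothesis.Theorems.FifoMatchingAv231Sum
import HarnessLib

/-!
# `FifoMatching.Av231InVP`: the 231-avoiding permanent is in VP

Closes item `stmt-ValiantsHypothesis-11620`: the family
`P_n = Σ_{σ ∈ Av_n(231)} ∏_i x_{i,σ(i)}` is a VP family, by the `O(n⁴)` block DP
`A[p;v;m] = Σ_a x_{p+a,v+m-1} A[p;v;a] A[p+a+1;v+a;m-1-a]` realised as a fan-in-two circuit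
(`isVPFamily_avRec`, file `FifoMatchingAv231Circuit.lean`) and the split at the maximum
(`sum_awt_eq`, file `FifoMatchingAv231Sum.lean`); permutations are re-indexed as bijective
self-maps (`Equiv.ofBijective`).
-/

noncomputable section

-- layout Summits/ValiantsHypothesis/ValiantsHypothesis forces the duplicated namespace component
set_option linter.dupNamespace false

namespace Summit.ValiantsHypothesis.ValiantsHypothesis.Theorems.FifoMatching

open MvPolynomial

/-! ### Closing: the item's family is the DP family -/

section Closing

/-- On the whole of `Fin n`, `IsAvOn 0 0 n` is injectivity plus 231-avoidance. [folklore] -/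
theorem isAvOn_zero_iff (n : ℕ) (f : Fin n → Fin n) :
    IsAvOn 0 0 n f ↔ (Function.Injective f ∧
      ∀ i j l : Fin n, i < j → j < l → f l < f i → f i < f j → False) := by
  constructor
  · rintro ⟨-, -, h3, h4⟩
    exact ⟨fun x y hxy => h3 x y (Nat.zero_le _) (by simp) (Nat.zero_le _)
      (by simp) hxy, fun i j l hij hjl h1 h2 => h4 i j l (Nat.zero_le _)
      (by simp) hij hjl h1 h2⟩
  · rintro ⟨h3, h4⟩
    refine ⟨fun x hx => absurd ⟨Nat.zero_le _, by simp⟩ hx,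
      fun x _ _ => ⟨Nat.zero_le _, by simp⟩, fun x y _ _ _ _ hxy => h3 hxy,
      fun i j l _ _ hij hjl h1 h2 => h4 i j l hij hjl h1 h2⟩

open scoped Classical in
/-- The 231-avoiding permanent equals the DP value `A[0;0;n]`. [folklore] -/
theorem sum_perms_eq_avRec (n : ℕ) :
    (∑ σ : Equiv.Perm (Fin n),
      if (∀ i j l : Fin n, i < j → j < l → σ l < σ i → σ i < σ j → False) then
        ∏ i : Fin n, MvPolynomial.X (i, σ i) else (0 : MvPolynomial (Fin n × Fin n) ℂ)) =
      avRec ℂ n 0 0 n := by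
  rw [← Finset.sum_filter]
  have hfun : ∑ σ ∈ Finset.univ.filter (fun σ : Equiv.Perm (Fin n) =>
        ∀ i j l : Fin n, i < j → j < l → σ l < σ i → σ i < σ j → False),
        ∏ i : Fin n, (MvPolynomial.X (i, σ i) : MvPolynomial (Fin n × Fin n) ℂ) =
      ∑ f ∈ Finset.univ.filter (fun f : Fin n → Fin n => IsAvOn 0 0 n f), awt ℂ 0 n f := by
    refine Finset.sum_bij' (fun σ _ => ⇑σ)
      (fun f hf => Equiv.ofBijective f (Finite.injective_iff_bijective.1
        ((isAvOn_zero_iff n f).1 (Finset.mem_filter.1 hf).2).1)) ?_ ?_ ?_ ?_ ?_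
    · intro σ hσ
      simp only [Finset.mem_filter, Finset.mem_univ, true_and] at hσ ⊢
      exact (isAvOn_zero_iff n σ).2 ⟨σ.injective, hσ⟩
    · intro f hf
      have hf' := (Finset.mem_filter.1 hf).2
      simp only [Finset.mem_filter, Finset.mem_univ, true_and, Equiv.ofBijective_apply]
      exact ((isAvOn_zero_iff n f).1 hf').2
    · intro σ hσ
      exact Equiv.ext fun x => rfl
    · intro f hf
      rfl
    · intro σ hσ
      unfold awt
      refine Finset.prod_congr rfl fun x _ => ?_
      rw [if_pos ⟨Nat.zero_le _, by simp⟩]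
  rw [hfun]
  refine sum_awt_eq (avRec ℂ n) (xa ℂ n) (fun i a hi ha => ?_) (avRec_zero n)
    (fun p v m hm _ _ => ?_) n n 0 0 le_rfl (by simp) (by simp)
  · unfold xa
    rw [dif_pos ⟨hi, ha⟩]
  · rw [avRec_of_pos n hm]
    rfl

/-- **Item `stmt-ValiantsHypothesis-11620`** (`FifoMatching.Av231InVP`): the 231-avoiding
permanents form a VP family. [folklore] -/
theorem av231InVP_proof :
    Summit.ValiantsHypothesis.ValiantsHypothesis.Theses.FifoMatching.Av231InVP := by
  unfold Summit.ValiantsHypothesis.ValiantsHypothesis.Theses.FifoMatching.Av231InVP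
  have hfam : (fun n => ∑ σ : Equiv.Perm (Fin n),
      if (∀ i j l : Fin n, i < j → j < l → σ l < σ i → σ i < σ j → False) then
        ∏ i : Fin n, MvPolynomial.X (i, σ i) else (0 : MvPolynomial (Fin n × Fin n) ℂ)) =
      fun n => avRec ℂ n 0 0 n := by
    funext n
    convert sum_perms_eq_avRec n
  rw [hfam]
  exact isVPFamily_avRec

end Closing

end Summit.ValiantsHypothesis.ValiantsHypothesis.Theorems.FifoMatching

end
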